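import Literature.AlgebraicGeometry.ModuliOfAbelianVarieties.SiegelAdmissibleOfIsoId
import Literature.AlgebraicGeometry.AbelianSchemes.AbelianSchemeDualTransportLambda
import Literature.AlgebraicGeometry.AbelianSchemes.AbelianSchemeDualTransportUnique
import HarnessLib

/-!
# Admissibility is invariant under isomorphism of triples over `Spec ℂ` — the polarisation half and the closed form
# ([MFK94] Def. 7.2 «up to isomorphism»; [Milne 2005] Thm. 6.11; [MilneAV2008] I §8 uniqueness of the dual)

Topic `Literature/AlgebraicGeometry/ModuliOfAbelianVarieties`; cell hodgecm-mathlib, U-DAG v0.1 §2 GLUE `U_of` row (α), THIRD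
and CLOSING part (B-plan1 R54; sequel of ★ `SiegelAdmissibleOfIso` (fibre form) and ★ `SiegelAdmissibleOfIsoId` (X / level
half)).  The remaining hypothesis `hpol` of ★ `isAdmissibleAt_of_isBaseChangeVia_id` — «every ample `IsLambdaOfAt` witness
`Θ` of `P′` pulls back along the fibre isomorphism to an ample `IsLambdaOfAt` witness of `P″`» — is DISCHARGED from the
hat / Poincaré / λ clauses of the D4 relation `P″.IsBaseChangeVia P′` along `𝟙` (the converse of Road-S K2/K3):

* §1 `PolarizedAbelianSchemeWithLevel.IsBaseChangeVia.hat_eq_hatTransport` — the dual component `Ĝ` of an isomorphism of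
  triples IS B-p01's dual transport `Ĥ_e` (uniqueness of the dual, ★ B-p12 `DualPair.eq_hatTransport_of_nonempty_pullback_map_iso`
  fed with the Poincaré clause); `….pol_lam_eq_lamTransport` — hence `λ″ = e ≫ λ′ ≫ Ĥ_{e⁻¹}` is B-p01's `lamTransport`
  (λ clause + ★ `hatTransport_comp_hatTransport`);
* §2 `….hpol` — ampleness of `e_s^*Θ` (★ `CartierDivisor.IsAmple.pullback`, an isomorphism is affine) and
  `IsLambdaOfAt` for `P″` (★ B-p01 `DualPair.isLambdaOfAt_lamTransport'` rewritten along §1), at EVERY field-valued point `s`;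
* §3 `isAdmissibleAt_of_isBaseChangeVia_id'` — **the closed D4-relation form of (α)**:
  `P″.IsBaseChangeVia P′ (𝟙 _).left G Ĝ → IsAdmissibleAt hδ r Z hZ P′ → IsAdmissibleAt hδ r Z hZ P″`, no further hypothesis.

Theorems only; no definition, no named fact, no instance, no `sorry`.  HC_CM is proved only modulo the 7 printed citations
until rung 0 closes; nothing here discharges a binder.

## References
* [MumfordFogartyKirwan1994] D. Mumford, J. Fogarty, F. Kirwan, *Geometric Invariant Theory*, 3rd ed., Ch. 6 §2 Def. 6.2
  (p. 120), Ch. 7 §2 Def. 7.2–7.3 (pp. 129–130).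
* [Milne2005ShimuraVarieties] J. S. Milne, *Introduction to Shimura Varieties* (2005/2017), §6 Thm. 6.11 pp. 74–75.
* [MilneAV2008] J. S. Milne, *Abelian Varieties* (2008), I §8 pp. 36–37 (uniqueness of the dual).
-/

noncomputable section

open CategoryTheory CategoryTheory.Limits AlgebraicGeometry MonoidalCategory

universe u

namespace Literature.AlgebraicGeometry.AbelianSchemes

namespace PolarizedAbelianSchemeWithLevel

open Literature.AlgebraicGeometry.Motives
open AbelianSchemeOver
open scoped MonObj

variable {g N : ℕ} {δ : Fin g → ℕ} {S : Scheme.{u}} {P' P'' : PolarizedAbelianSchemeWithLevel g N δ S}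
  (e : P''.A.X ≅ P'.A.X) [IsMonHom e.hom] {Ĝ : P''.D.hat.X.left ⟶ P'.D.hat.X.left}

/-! ## §1 The dual component of an isomorphism of triples is the dual transport; `λ″` is the transported `λ′` -/

/-- **The dual component `Ĝ` of an isomorphism of triples along `𝟙 S` IS the dual transport `Ĥ_e`** ([MilneAV2008] I §8:
the dual is unique up to a unique isomorphism): the Poincaré clause of `IsBaseChangeVia` says `(e × Ĝ)^*𝒫′ ≅ 𝒫″`, which is
exactly the classifying property of `Ĥ_e` (★ `DualPair.eq_hatTransport_of_nonempty_pullback_map_iso`).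
[cite: MilneAV2008, I §8 pp. 36–37] [cite: MumfordFogartyKirwan1994, Ch. 7 §2 Definition 7.3 (p. 130)] -/
theorem IsBaseChangeVia.hat_eq_hatTransport (hBC : P''.IsBaseChangeVia P' (𝟙 S) e.hom.left Ĝ) :
    Ĝ = DualPair.hatTransport P'.D P''.D e := by
  obtain ⟨-, -, ⟨wG, wĜ, hP⟩, -⟩ := hBC
  exact DualPair.eq_hatTransport_of_nonempty_pullback_map_iso P'.D P''.D e Ĝ wG wĜ hP

/-- **`λ″ = e ≫ λ′ ≫ Ĥ_{e⁻¹}`**: the polarisation of `P″` is B-p01's transported polarisation `lamTransport P′.D P″.D e e⁻¹ λ′`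
— from the λ clause `λ″ ≫ Ĝ = e ≫ λ′`, §1 `Ĝ = Ĥ_e` and `Ĥ_e ≫ Ĥ_{e⁻¹} = 𝟙` (★ `hatTransport_comp_hatTransport`).
[cite: MumfordFogartyKirwan1994, Ch. 7 §2 Definition 7.3 (p. 130)] [cite: MilneAV2008, I §8 pp. 36–37] -/
theorem IsBaseChangeVia.pol_lam_eq_lamTransport (hBC : P''.IsBaseChangeVia P' (𝟙 S) e.hom.left Ĝ) :
    haveI : IsMonHom e.symm.hom := by change IsMonHom e.inv; infer_instance
    P''.pol.lam = DualPair.lamTransport P'.D P''.D e e.symm P'.pol.lam := by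
  haveI : IsMonHom e.symm.hom := by change IsMonHom e.inv; infer_instance
  have hĜ := IsBaseChangeVia.hat_eq_hatTransport e hBC
  have hlam : P''.pol.lam.left ≫ Ĝ = e.hom.left ≫ P'.pol.lam.left := hBC.2.2.2
  have he' : e.symm.hom = e.inv := rfl
  have hinv : DualPair.hatTransport P'.D P''.D e ≫ DualPair.hatTransport P''.D P'.D e.symm = 𝟙 _ :=
    DualPair.hatTransport_comp_hatTransport P''.D P'.D e.symm e (DualPair.hom_eq_inv_of_hom_eq_inv e e.symm he')
  ext
  rw [DualPair.lamTransport_left, ← Category.assoc, ← hlam, hĜ, Category.assoc, hinv, Category.comp_id]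

/-! ## §2 The polarisation transfer `hpol` along an isomorphism of triples -/

/-- **POLARISATION TRANSFER ALONG AN ISOMORPHISM OF TRIPLES** (the `hpol` of ★ `isAdmissibleAt_of_isBaseChangeVia_id`, at
every field-valued point `s`): if `P″` is related to `P′` along `𝟙 S` through `(e, Ĝ)` and `Θ` is an ample witness of
`λ̄′ = Λ(𝒪(Θ))` at `s`, then `e_s^*Θ` is ample (pull-back along the isomorphism `e_s`, ★ `CartierDivisor.IsAmple.pullback`)
and witnesses `λ̄″ = Λ(𝒪(e_s^*Θ))` at `s` (★ `DualPair.isLambdaOfAt_lamTransport'` for B-p01's `lamTransport`, which §1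
identifies with `λ″`). [cite: MumfordFogartyKirwan1994, Ch. 6 §2 Definition 6.2 (p. 120) and Ch. 7 §2 Definition 7.3 (p. 130)]
[cite: MilneAV2008, I §8 pp. 36–37] -/
theorem IsBaseChangeVia.hpol (hBC : P''.IsBaseChangeVia P' (𝟙 S) e.hom.left Ĝ) {Ω : Type u} [Field Ω]
    (s : Spec (.of Ω) ⟶ S) (Θ : CartierDivisor (P'.A.fibre s).toAbelianVariety.X.left) (hΘ : Θ.IsAmple)
    (hlam : P'.A.IsLambdaOfAt s P'.D P'.pol.lam Θ) :
    haveI := AbelianVariety.isDominant_toSchemeHom_iso_hom (fibreIsoOfIso e s)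
    (Θ.pullback (AbelianVariety.Hom.toSchemeHom (fibreIsoOfIso e s).hom)).IsAmple ∧
      P''.A.IsLambdaOfAt s P''.D P''.pol.lam (Θ.pullback (AbelianVariety.Hom.toSchemeHom (fibreIsoOfIso e s).hom)) := by
  haveI := AbelianVariety.isDominant_toSchemeHom_iso_hom (fibreIsoOfIso e s)
  haveI := AbelianSchemeOver.isIso_toSchemeHom_of_iso (fibreIsoOfIso e s)
  haveI : IsMonHom e.symm.hom := by change IsMonHom e.inv; infer_instance
  refine ⟨hΘ.pullback _, ?_⟩
  rw [IsBaseChangeVia.pol_lam_eq_lamTransport e hBC]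
  exact DualPair.isLambdaOfAt_lamTransport' e s P'.D P''.D e.symm P'.pol.lam rfl hlam

end PolarizedAbelianSchemeWithLevel

end Literature.AlgebraicGeometry.AbelianSchemes

/-! ## §3 The closed D4-relation form of (α) -/

namespace Literature.AlgebraicGeometry.ModuliOfAbelianVarieties

open Literature.AlgebraicGeometry.Motives (SchemeOver ComplexPoints AlgPoints specOver AbelianVariety CartierDivisor)
open Literature.AlgebraicGeometry.AbelianSchemes (PolarizedAbelianSchemeWithLevel AbelianSchemeOver)
open Literature.NumberTheory.Automorphic (siegelUpperHalfSpace)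

/-- **ADMISSIBILITY IS INVARIANT UNDER ISOMORPHISM OF TRIPLES over `Spec ℂ` — closed form** ([MumfordFogartyKirwan1994]
Def. 7.2 «all up to isomorphism»; [Milne2005ShimuraVarieties] Thm. 6.11: the class of `(A, s, ηK)` depends on the isomorphism
class only): if `P″` is related to `P′` by the D4 relation `IsBaseChangeVia` along `𝟙 (Spec ℂ)` (through any `(G, Ĝ)`), then
`P′` admissible at `(Z, r)` implies `P″` admissible at `(Z, r)`.  Assembly: ★ `isAdmissibleAt_of_isBaseChangeVia_id` (X / level
half, with `e.hom.left = G` substituted) + §2 `hpol` (polarisation half).  The U-DAG glue step «(U3∃) = D-BC∃ ★ + admissibility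
transport along `univ ×_𝓜 classify(P) ≅ P`» consumes exactly this shape.
[cite: MumfordFogartyKirwan1994, Ch. 7 §2 Definition 7.2 (p. 129) and Definition 7.3 (p. 130)]
[cite: Milne2005ShimuraVarieties, §6 Thm. 6.11 pp. 74–75] -/
theorem isAdmissibleAt_of_isBaseChangeVia_id' {g N : ℕ} {δ : Fin g → ℕ} (hδ : IsPolarizationType δ) {r : gspFinAdelic δ}
    {Z : Matrix (Fin g) (Fin g) ℂ} {hZ : Z ∈ siegelUpperHalfSpace g}
    {P' P'' : PolarizedAbelianSchemeWithLevel g N δ (specOver ℚ ℂ).left}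
    {G : P''.A.X.left ⟶ P'.A.X.left} {Ĝ : P''.D.hat.X.left ⟶ P'.D.hat.X.left}
    (hBC : P''.IsBaseChangeVia P' (𝟙 (specOver ℚ ℂ) : specOver ℚ ℂ ⟶ specOver ℚ ℂ).left G Ĝ)
    (h : IsAdmissibleAt hδ r Z hZ P') : IsAdmissibleAt hδ r Z hZ P'' := by
  refine isAdmissibleAt_of_isBaseChangeVia_id hδ hBC (fun e _ heG Θ hΘ hlam => ?_) h
  subst heG
  exact PolarizedAbelianSchemeWithLevel.IsBaseChangeVia.hpol e hBC _ Θ hΘ hlam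

end Literature.AlgebraicGeometry.ModuliOfAbelianVarieties

end
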